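import Mathlib
import Summits.ValiantsHypothesis.ValiantsHypothesis.Theorems.DivisionGapPerMultiplesHardStubSpreadCaptureRel

/-!
# Hybrid relative capture (line `uncharged-face-walk` of crux `PerMultiplesHard`, route
DivisionGap; stub `stub_hybridCaptureRel`)

Pure finite combinatorics on permutations of `Fin n`.  Fix a row shift `ζ : Equiv.Perm (Fin n)`,
a row set `S`, a column set `T` and a comparison set `P` of permutations.  The two halves of the
compatibility predicate of `SpreadCaptureRel` are used SEPARATELY here:
(C) every `j ∈ T` has `π j ∈ S` or `π j ∈ ζ(S)` (column condition), and
(H) every `i ∈ S'` has `π⁻¹ i ∈ T'` or `π⁻¹ (ζ i) ∈ T'` (hitting condition, with its own sets).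

* (C) alone already says `U := π(T) ⊆ W := S ∪ ζ(S)` with `#U = #T` (`image_sub_of_col`), so the
  (C)-part of `P` is covered by the fibres `{π ∈ P : π(T) = U}` over `U ∈ W.powersetCard #T`, of
  which there are `C(#W, #T) ≤ C(2 #S, #T)`; if every fibre has at most `M` elements the (C)-part
  has at most `C(2 #S, #T) · M` elements (`card_col_le`).  Also (C) forces `#T = #U ≤ #W ≤ 2 #S`
  (`card_le_of_col`).
* (H) alone says `S' ⊆ π(T') ∪ ζ⁻¹(π(T'))`, so `#S' ≤ 2 #T'` (`card_le_of_row`).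

The registered stub `stub_hybridCaptureRel` is the conjunction of the three facts.

-- adapted from Theorems/DivisionGapPerMultiplesHardStubSpreadCaptureRel.lean
(`image_valid_of_compatible`, `card_bounds_of_compatible`, `card_compatible_le`, each with one
conjunct of the compatibility predicate dropped)
-/

noncomputable section

-- the namespace `Summit.ValiantsHypothesis.ValiantsHypothesis.…` is mandated by the crux (registered stub names)
set_option linter.dupNamespace false

namespace Summit.ValiantsHypothesis.ValiantsHypothesis.Theorems.DivisionGap.PerMultiplesHard.HybridCaptureRel

open Finset
open scoped BigOperators

/-- **The column condition controls the image.**  If every `j ∈ T` has `π j ∈ S` or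
`π j = ζ i` for some `i ∈ S`, then `U := π(T)` lies in `S ∪ ζ(S)` and has `#U = #T`.
[folklore] -/
theorem image_sub_of_col {n : ℕ} (ζ : Equiv.Perm (Fin n)) (S T : Finset (Fin n))
    (π : Equiv.Perm (Fin n)) (hb : ∀ j ∈ T, π j ∈ S ∨ ∃ i ∈ S, ζ i = π j) :
    T.image ⇑π ⊆ S ∪ S.image ⇑ζ ∧ (T.image ⇑π).card = T.card := by
  refine ⟨?_, Finset.card_image_of_injective _ π.injective⟩
  intro x hx
  rw [Finset.mem_image] at hx
  obtain ⟨j, hj, rfl⟩ := hx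
  rcases hb j hj with h | ⟨i, hi, h⟩
  · exact Finset.mem_union_left _ h
  · exact Finset.mem_union_right _ (Finset.mem_image.mpr ⟨i, hi, h⟩)

/-- **Size constraint from the column condition.**  If some `π` satisfies the column condition
for `(S, T)` and the shift `ζ`, then `#T ≤ 2 #S`: indeed `#T = #π(T)` and `π(T) ⊆ S ∪ ζ(S)`.
[folklore] -/
theorem card_le_of_col {n : ℕ} (ζ : Equiv.Perm (Fin n)) (S T : Finset (Fin n))
    (π : Equiv.Perm (Fin n)) (hb : ∀ j ∈ T, π j ∈ S ∨ ∃ i ∈ S, ζ i = π j) :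
    T.card ≤ 2 * S.card := by
  obtain ⟨hUW, hUcard⟩ := image_sub_of_col ζ S T π hb
  calc T.card = (T.image ⇑π).card := hUcard.symm
    _ ≤ (S ∪ S.image ⇑ζ).card := Finset.card_le_card hUW
    _ ≤ S.card + (S.image ⇑ζ).card := Finset.card_union_le _ _
    _ ≤ S.card + S.card := Nat.add_le_add_left Finset.card_image_le _
    _ = 2 * S.card := by ring

/-- **Size constraint from the hitting condition.**  If some `π` has `π⁻¹ i ∈ T'` or
`π⁻¹ (ζ i) ∈ T'` for every `i ∈ S'`, then `#S' ≤ 2 #T'`: the set `S'` is covered by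
`π(T') ∪ ζ⁻¹(π(T'))`, each of size at most `#T'`. [folklore] -/
theorem card_le_of_row {n : ℕ} (ζ : Equiv.Perm (Fin n)) (S' T' : Finset (Fin n))
    (π : Equiv.Perm (Fin n)) (ha : ∀ i ∈ S', π.symm i ∈ T' ∨ π.symm (ζ i) ∈ T') :
    S'.card ≤ 2 * T'.card := by
  have hSsub : S' ⊆ T'.image ⇑π ∪ T'.image (fun j => ζ.symm (π j)) := by
    intro i hi
    rcases ha i hi with h | h
    · exact Finset.mem_union_left _ (Finset.mem_image.mpr ⟨π.symm i, h, π.apply_symm_apply i⟩)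
    · refine Finset.mem_union_right _ (Finset.mem_image.mpr ⟨π.symm (ζ i), h, ?_⟩)
      simp only [Equiv.apply_symm_apply, Equiv.symm_apply_apply]
  calc S'.card ≤ (T'.image ⇑π ∪ T'.image (fun j => ζ.symm (π j))).card := Finset.card_le_card hSsub
    _ ≤ (T'.image ⇑π).card + (T'.image (fun j => ζ.symm (π j))).card := Finset.card_union_le _ _
    _ ≤ T'.card + T'.card := Nat.add_le_add Finset.card_image_le Finset.card_image_le
    _ = 2 * T'.card := by ring

/-- **Relative capture count, column condition only.**  Fix `ζ`, `S`, `T` and a comparison set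
`P`.  If every fibre `{π ∈ P : π(T) = U}` over a `U ⊆ S ∪ ζ(S)` with `#U = #T` has at most `M`
elements, then the part of `P` satisfying the column condition for `(S, T)` has at most
`C(2 #S, #T) · M` elements: it is covered by the fibres over the `U ∈ (S ∪ ζ(S)).powersetCard #T`,
and there are `C(#(S ∪ ζ(S)), #T) ≤ C(2 #S, #T)` of those. [folklore] -/
theorem card_col_le {n : ℕ} (ζ : Equiv.Perm (Fin n)) (S T : Finset (Fin n))
    (P : Finset (Equiv.Perm (Fin n))) (M : ℕ)
    (hM : ∀ U : Finset (Fin n), U ⊆ S ∪ S.image ⇑ζ → U.card = T.card →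
      (P.filter fun π : Equiv.Perm (Fin n) => T.image ⇑π = U).card ≤ M) :
    (P.filter fun π : Equiv.Perm (Fin n) =>
        ∀ j ∈ T, π j ∈ S ∨ ∃ i ∈ S, ζ i = π j).card ≤ (2 * S.card).choose T.card * M := by
  -- the pieces of the count
  set u : ℕ := T.card with hu
  set W : Finset (Fin n) := S ∪ S.image ⇑ζ with hW
  set V : Finset (Finset (Fin n)) := W.powersetCard u with hV
  set Fib : Finset (Fin n) → Finset (Equiv.Perm (Fin n)) := fun U =>
    P.filter fun π : Equiv.Perm (Fin n) => T.image ⇑π = U with hFib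
  set C : Finset (Equiv.Perm (Fin n)) :=
    P.filter fun π : Equiv.Perm (Fin n) => ∀ j ∈ T, π j ∈ S ∨ ∃ i ∈ S, ζ i = π j with hC
  -- (1) the column condition depends only on the image `π(T)`, which must lie in `V`
  have hsub : C ⊆ V.biUnion Fib := by
    intro π hπ
    rw [hC, Finset.mem_filter] at hπ
    obtain ⟨hπP, hb⟩ := hπ
    obtain ⟨hUW, hUcard⟩ := image_sub_of_col ζ S T π hb
    rw [Finset.mem_biUnion]
    refine ⟨T.image ⇑π, ?_, ?_⟩
    · rw [hV, Finset.mem_powersetCard]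
      exact ⟨hUW, hUcard⟩
    · rw [hFib, Finset.mem_filter]
      exact ⟨hπP, rfl⟩
  -- (2) there are at most `C(2 #S, u)` admissible images
  have hWcard : W.card ≤ 2 * S.card := by
    calc W.card ≤ S.card + (S.image ⇑ζ).card := Finset.card_union_le _ _
      _ ≤ S.card + S.card := Nat.add_le_add_left Finset.card_image_le _
      _ = 2 * S.card := by ring
  have hVcard : V.card ≤ (2 * S.card).choose u := by
    calc V.card = W.card.choose u := Finset.card_powersetCard _ _
      _ ≤ (2 * S.card).choose u := Nat.choose_le_choose u hWcard
  -- (3) each fibre over an admissible image has at most `M` elements, so `#C ≤ C(2 #S, u) · M`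
  calc C.card ≤ (V.biUnion Fib).card := Finset.card_le_card hsub
    _ ≤ ∑ U ∈ V, (Fib U).card := Finset.card_biUnion_le
    _ ≤ ∑ _U ∈ V, M := by
        refine Finset.sum_le_sum fun U hUV => ?_
        rw [hV, Finset.mem_powersetCard] at hUV
        exact hM U hUV.1 hUV.2
    _ = V.card * M := by rw [Finset.sum_const, smul_eq_mul]
    _ ≤ (2 * S.card).choose u * M := Nat.mul_le_mul_right _ hVcard

/-- **stub_hybridCaptureRel — captures split into few fibres, one-sided forms** (registered stub;
`SpreadCaptureRel.stub_spreadCaptureRel` with the two halves of the compatibility predicate used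
separately).  (1) If every fibre `{π ∈ P : π(T) = U}` with `U ⊆ S ∪ ζ(S)`, `#U = #T` has at most
`M` elements, then `#{π ∈ P : ∀ j ∈ T, π j ∈ S ∨ ∃ i ∈ S, ζ i = π j} ≤ C(2 #S, #T) · M` (such `π`
have `π(T) ⊆ S ∪ ζ(S)`; at most `C(#(S ∪ ζ(S)), #T) ≤ C(2 #S, #T)` images).  (2) If some `π` has
`π⁻¹ i ∈ T'` or `π⁻¹ (ζ i) ∈ T'` for every `i ∈ S'`, then `#S' ≤ 2 #T'`
(`S' ⊆ π(T') ∪ ζ⁻¹(π(T'))`).  (3) If some `π` satisfies the condition of (1), then `#T ≤ 2 #S`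
(`π(T) ⊆ S ∪ ζ(S)`). [folklore] -/
theorem stub_hybridCaptureRel :
    ∀ (n : ℕ) (ζ : Equiv.Perm (Fin n)) (S T S' T' : Finset (Fin n)) (P : Finset (Equiv.Perm (Fin n))) (M : ℕ),
      ((∀ U : Finset (Fin n), U ⊆ S ∪ S.image ⇑ζ → U.card = T.card →
          (P.filter fun π : Equiv.Perm (Fin n) => T.image ⇑π = U).card ≤ M) →
        (P.filter fun π : Equiv.Perm (Fin n) => ∀ j ∈ T, π j ∈ S ∨ ∃ i ∈ S, ζ i = π j).card ≤
          (2 * S.card).choose T.card * M) ∧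
      ((∃ π : Equiv.Perm (Fin n), ∀ i ∈ S', π.symm i ∈ T' ∨ π.symm (ζ i) ∈ T') → S'.card ≤ 2 * T'.card) ∧
      ((∃ π : Equiv.Perm (Fin n), ∀ j ∈ T, π j ∈ S ∨ ∃ i ∈ S, ζ i = π j) → T.card ≤ 2 * S.card) := by
  intro n ζ S T S' T' P M
  refine ⟨fun hM => card_col_le ζ S T P M hM, ?_, ?_⟩
  · rintro ⟨π, hπ⟩
    exact card_le_of_row ζ S' T' π hπ
  · rintro ⟨π, hπ⟩
    exact card_le_of_col ζ S T π hπ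

end Summit.ValiantsHypothesis.ValiantsHypothesis.Theorems.DivisionGap.PerMultiplesHard.HybridCaptureRel

end
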